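import Summits.BirchSwinnertonDyer.BirchSwinnertonDyer.Theorems.KolyvaginDepthDoorMSymbolCert916c1Check
import Summits.BirchSwinnertonDyer.BirchSwinnertonDyer.Theorems.KolyvaginDepthDoorMSymbolCert916c1K
import Summits.BirchSwinnertonDyer.BirchSwinnertonDyer.Theorems.KolyvaginDepthDoorMSymbolCert916c1KSum0
import Summits.BirchSwinnertonDyer.BirchSwinnertonDyer.Theorems.KolyvaginDepthDoorMSymbolCert916c1KSum1
import Summits.BirchSwinnertonDyer.BirchSwinnertonDyer.Theorems.KolyvaginDepthDoorDepthTableKuriharaESideFive2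
import Summits.BirchSwinnertonDyer.BirchSwinnertonDyer.Theorems.KolyvaginDepthDoorDepthTableAdditiveSurjectivityB
import Summits.BirchSwinnertonDyer.BirchSwinnertonDyer.Theorems.KatoDescentTamePotSupersingularTameUpperUnitTwistRecordToolsConductor
import HarnessLib

/-!
# Route `KolyvaginDepthDoor`, crux `KolyvaginDepthSupplyKN` (stmt-BirchSwinnertonDyer-22820) —
# DEPTH TABLE v30 «THE PRIME-POWER INDEX BLOCK»: the E-side Kurihara claim of the rank-two curve `916c1` (conductor
# `916 = 2^2·229`) @ `(5, 11·31)` is a KERNEL THEOREM; `Ш(916c1/ℚ)[5] = 0` from print facts only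

Helper file of the lead prover of line `levelone` (kdd-p1 g35; `--supports stmt-BirchSwinnertonDyer-22820 --as helper`); it
closes nothing and BSD is NOT proved by it. g34 listed `916c1` among the three rank-two curves `N < 1000` whose E-side is out of kernel reach
for want of a PRIME-POWER index block (kits 1/1′ index `ℙ¹(ℤ/N)` for `N` prime or a product of two primes); kit 1″
(`…MSymbolCertCosetsQ/CosetsCQ/RelationsCQ/PeriodsCQ/KuriharaCQ`, this gen) indexes `ℙ¹(ℤ/2^2) × ℙ¹(ℤ/229)`. At `p = 5` —
admissible for `916c1`: good ordinary, `ρ̄_{E,5}` onto, non-anomalous, Kodaira–Néron, and `341 = 11·31` a CYCLIC Kolyvagin level,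
all kernel theorems of the tree already (`…DepthTableKuriharaESideFive2`) — the level costs 4886 steps. This file (i) certifies the CONDUCTOR
`N(916c1) = 916` in the kernel (Kodaira `IV` at `2` by Tate's algorithm on a Step-2 integer model + Ogg's formula, tool
`…TameUpperUnitTwistRecordToolsConductor`; the tree had `conductorNorm_eq` for the semistable rows only), (ii) assembles the 2 kernel
pieces `kSumPiece0‥1` into `kSum ≢ 0 (mod 5)` (`≡ 3`), (iii) `exists_kuriharaNumber_ne_zero_916c1` (kit 4″
`exists_kuriharaNumber_ne_zero_wCQ` on the certified plus M-symbol `cert916c1_check`), (iv) **`C916c1.kuriharaClaim_5_341`** —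
literally the hypothesis `hδ` of v17's reader `C916c1.sha_inf_torsionBy_five_eq_bot_of_kuriharaClaim` (so far the claim of a PARI record taken on trust) — and
(v) **`C916c1.sha_inf_torsionBy_five_eq_bot_of_print`**: `Ш(916c1/ℚ)[5] = 0` granted Kim Thm. 1.11, modularity and Mazur Cor. 4.1
BY NAME only. Per curve; nothing class-wide.

References: [Kim2022StructureSelmer] Thm. 1.11, §1.4.3; [Mazur1978] Cor. 4.1; [CremonaAlgorithms1997] §2.2–2.5, Table 1 (916c1);
[SilvermanATAEC1994] IV.9.4, IV.10.2, IV.11.1; [SilvermanAEC2009] C.16.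
-/

set_option linter.dupNamespace false

noncomputable section

open scoped MatrixGroups ModularForm Classical NumberField
open CongruenceSubgroup
open Literature.NumberTheory.EllipticCurves Literature.NumberTheory.EllipticCurves.ModularForms
open Summit.BirchSwinnertonDyer.BirchSwinnertonDyer.Rank2Observatory
open Summit.BirchSwinnertonDyer.BirchSwinnertonDyer.Theorems.KolyvaginDepthDoor.MSymbolCert.Level341
open Summit.BirchSwinnertonDyer.BirchSwinnertonDyer.Theorems.KolyvaginDepthDoor.MSymbolCert.Cert794a1 (list_range'_map_sum_split)

namespace Summit.BirchSwinnertonDyer.BirchSwinnertonDyer.Theorems.KolyvaginDepthDoor.MSymbolCert.Cert916c1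

/-! ## §1 The Kurihara sum is non-zero mod `5` -/

/-- **The Kurihara sum of `916c1` at `(5, 341)` is `≢ 0 (mod 5)`** (`≡ 3`; two kernel pieces). [cite: Kim2022StructureSelmer, §1.4.3] -/
theorem kSum_ne_zero :
    kSum 5 341 (fun k => chainSumCQ 2 2 229 phi916c1 342 341 (w341 k : ℤ)) (341 : ℕ).primeFactors T341 ≠ 0 := by
  rw [kSum_eq_sum_gE916, sum_range_eq_of_chunks2 gE916 341 228 113 rfl _ _ kSumPiece0 kSumPiece1]
  decide

/-! ## §2 The Kurihara number of the newform of `916c1` -/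

/-- **`δ̃_{341}(916c1) ≢ 0 (mod 5)` — KERNEL-CERTIFIED at the level `916 = 2^2·229`** for any modular parametrisation datum of
`916c1` at a level equal to `2^2·229` (kit 4″ `exists_kuriharaNumber_ne_zero_wCQ`). [cite: Kim2022StructureSelmer, §1.4.3] [cite: CremonaAlgorithms1997, §2.2–2.5] -/
theorem exists_kuriharaNumber_ne_zero_916c1 (N : ℕ) (hN : N = 2 ^ 2 * 229) [NeZero N]
    (D : haveI := isElliptic_c916c1; ModularParametrizationData (((⟨0, 0, 0, -4, 1⟩ : WeierstrassCurve ℤ).map (Int.castRingHom ℚ))) N) :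
    ∃ ψ : (ℓ : ℕ) → (ZMod ℓ)ˣ →* Multiplicative (ZMod 5),
      (∀ ℓ ∈ (341 : ℕ).primeFactors, Function.Surjective (ψ ℓ)) ∧ kuriharaNumber D.f 5 341 ψ ≠ 0 := by
  have hT3 := heckeT3_916c1 N hN D
  have hT5 := heckeT5_916c1 N hN D
  subst hN
  haveI := isElliptic_c916c1
  haveI := isGloballyMinimal_c916c1
  haveI : Fact (Nat.Prime 5) := ⟨by norm_num⟩
  haveI : NeZero (341 : ℕ) := ⟨by norm_num⟩
  have hf := D.isNewformOf
  have hreal : ∀ m, (cuspCoeff D.f m).im = 0 := cuspCoeff_im_eq_zero_of_coeffField_eq_bot hf.coeffField_eq_bot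
  have hF : ∀ k < 6900, eval (ΨCQ D.f) (gen916c1 k) = 0 := fun k _ => pool_holds D.f hreal hT3 hT5 k
  obtain ⟨t, ht⟩ := exists_eq_smul_of_checkF cert916c1 gen916c1 6900 1380 phi916c1 cert916c1_check (ΨCQ D.f) hF
  have hΨ : ∀ i < (2 ^ 2 + 2 ^ 2 / 2) * (229 + 1), ΨCQ D.f i = t * phi916c1 i :=
    fun i hi => ht i (by norm_num at hi; omega)
  have hirr : (((⟨0, 0, 0, -4, 1⟩ : WeierstrassCurve ℤ).map (Int.castRingHom ℚ))).HasIrreducibleModPGaloisRep 5 :=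
    hasIrreducibleModPGaloisRep_of_hasSurjectiveModNGaloisRep _ 5 C916c1.hasSurjectiveModNGaloisRep_5
  exact exists_kuriharaNumber_ne_zero_wCQ D.f 5 341 hf (by norm_num) hirr (by norm_num) hΨ w341 342 (by norm_num)
    bezout_341 1 (by norm_num) (by norm_num) unit_witness T341 T341_ok T341_surj kSum_ne_zero

end Summit.BirchSwinnertonDyer.BirchSwinnertonDyer.Theorems.KolyvaginDepthDoor.MSymbolCert.Cert916c1

/-! ## §3 The conductor; the E-side claim of the row; `Ш(916c1)[5] = 0` from print -/

namespace Summit.BirchSwinnertonDyer.BirchSwinnertonDyer.Theorems.KolyvaginDepthDoor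

open WeierstrassCurve NumberField IsDedekindDomain
open Summit.BirchSwinnertonDyer.BirchSwinnertonDyer.Theorems
open Literature.NumberTheory.DiophantineGeometry
open Summit.BirchSwinnertonDyer.BirchSwinnertonDyer.Theorems.TameUpperUnitTwistRecords
open Summit.BirchSwinnertonDyer.Rank1Residual.Additive (placeOf)
open Summit.BirchSwinnertonDyer.BirchSwinnertonDyer.Rank1Residual.IntModel (map_mk_int)

namespace C916c1

/-- **Conductor of `916c1`: `N = 916 = 2^2·229`** — KERNEL, from the integer model (`|Δ| = 2^4·229`): Kodaira `IV` at `2`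
(Tate's algorithm on the Step-2 model `⟨0, 0, 2, -4, 0⟩`, translation `⟨1, 0, 0, 1⟩`; Ogg's formula `f₂ = 4 + 1 − m`), `f = 1` at the
multiplicative prime(s) (`p ∤ c₄`); assembled by `conductorNorm_eq_of_exponents`. [cite: SilvermanATAEC1994, IV.9.4, IV.10.2, IV.11.1]
[cite: SilvermanAEC2009, C.16] [cite: CremonaAlgorithms1997, Table 1 (916c1, column N)] -/
theorem conductorNorm_eq : haveI := isElliptic_c916c1; (((⟨0, 0, 0, -4, 1⟩ : WeierstrassCurve ℤ).map (Int.castRingHom ℚ))).conductorNorm ℤ = 916 := by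
  haveI := isElliptic_c916c1
  haveI := isGloballyMinimal_c916c1
  have hI := intModel
  have hK2 : (((⟨0, 0, 0, -4, 1⟩ : WeierstrassCurve ℤ).map (Int.castRingHom ℚ))).kodairaSymbolAt (placeOf 2) = .IV :=
    kodairaSymbolAt_placeOf_eq_IV_of_intModel 2 _ (⟨0, 0, 2, -4, 0⟩ : WeierstrassCurve ℤ) ⟨1, 0, 0, 1⟩
      (by
        rw [map_mk_int]
        ext <;> norm_num [WeierstrassCurve.variableChange_a₁, WeierstrassCurve.variableChange_a₂,
          WeierstrassCurve.variableChange_a₃, WeierstrassCurve.variableChange_a₄, WeierstrassCurve.variableChange_a₆])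
      (by decide +kernel) (by decide +kernel) (by decide +kernel) (by decide +kernel) (by decide +kernel) (by decide +kernel) (by decide +kernel) (by decide +kernel)
  have h := conductorNorm_eq_of_exponents hI (G := [(2, 4), (229, 1)]) (by decide +kernel)
    (by intro qe hqe; simp only [List.mem_cons, List.not_mem_nil, or_false] at hqe
        rcases hqe with rfl | rfl <;> norm_num)
    [(2, 2), (229, 1)]
    (by intro qf hqf; simp only [List.mem_cons, List.not_mem_nil, or_false] at hqf
        rcases hqf with rfl | rfl <;> norm_num)
    (by decide) (by decide)
    (by
      intro qf hqf
      simp only [List.mem_cons, List.not_mem_nil, or_false] at hqf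
      rcases hqf with rfl | rfl
      · exact (conductorExponent_natPlace_eq_of_kodairaSymbolAt hI 2 hK2 (n := 4) (by decide +kernel) (by decide +kernel)).trans (by decide)
      · exact conductorExponent_natPlace_eq_one_of_dvd_of_not_dvd hI (by norm_num) (by decide +kernel) (by decide +kernel))
  rw [h]; norm_num

/-- **THE E-SIDE KURIHARA CLAIM OF `916c1` @ `(5, 11·31)` IS A THEOREM** — literally the hypothesis `hδ` of v17's reader
`sha_inf_torsionBy_five_eq_bot_of_kuriharaClaim` (and the right-hand side of v22's two-way row). [cite: Kim2022StructureSelmer, §1.4.3] [cite: CremonaAlgorithms1997, §2.2–2.5] -/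
theorem kuriharaClaim_5_341 :
    haveI := isElliptic_c916c1; haveI := isGloballyMinimal_c916c1;
      haveI : NeZero ((((⟨0, 0, 0, -4, 1⟩ : WeierstrassCurve ℤ).map (Int.castRingHom ℚ))).conductorNorm ℤ) := neZero_conductorNorm_of_isElliptic _;
      haveI := Fact.mk (by norm_num : Nat.Prime 5);
      ∀ (D : ModularParametrizationData (((⟨0, 0, 0, -4, 1⟩ : WeierstrassCurve ℤ).map (Int.castRingHom ℚ))) ((((⟨0, 0, 0, -4, 1⟩ : WeierstrassCurve ℤ).map (Int.castRingHom ℚ))).conductorNorm ℤ)), ¬ ((5 : ℕ) : ℤ) ∣ D.maninConstant →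
        (∃ u : ℚ, ‖(u : ℚ_[5])‖ = 1 ∧ (((⟨0, 0, 0, -4, 1⟩ : WeierstrassCurve ℤ).map (Int.castRingHom ℚ))).realPeriodRat = u * plusPeriod D.f) →
        ∃ ψ : (ℓ : ℕ) → (ZMod ℓ)ˣ →* Multiplicative (ZMod 5),
          (∀ ℓ ∈ (341 : ℕ).primeFactors, Function.Surjective (ψ ℓ)) ∧ kuriharaNumber D.f 5 341 ψ ≠ 0 := by
  intro D _ _
  haveI := isElliptic_c916c1
  haveI : NeZero ((((⟨0, 0, 0, -4, 1⟩ : WeierstrassCurve ℤ).map (Int.castRingHom ℚ))).conductorNorm ℤ) := neZero_conductorNorm_of_isElliptic _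
  exact MSymbolCert.Cert916c1.exists_kuriharaNumber_ne_zero_916c1 _ (conductorNorm_eq.trans (by norm_num)) D

/-- **`Ш(916c1/ℚ)[5] = 0` FROM PRINT FACTS ONLY** (Kim Thm. 1.11 `hKim`, modularity `hnf`, Mazur Cor. 4.1 `hMaz` BY NAME): v17's reader
`sha_inf_torsionBy_five_eq_bot_of_kuriharaClaim` (`…DepthTableKuriharaESideFive2`: `5` good ordinary, `ρ̄_{E,5}` onto, non-anomalous, Kodaira–Néron, cyclic level `341`,
`2 ≤ rank`) with its claim hypothesis `hδ` DISCHARGED by `kuriharaClaim_5_341`. CONDITIONAL on the three named facts; per curve; BSD is not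
proved by it. [cite: Kim2022StructureSelmer, Thm. 1.11 (PDF p. 8)] [cite: Mazur1978, Cor. 4.1] [cite: CremonaAlgorithms1997, Table 1 (916c1)] -/
theorem sha_inf_torsionBy_five_eq_bot_of_print
    (hKim : Kim2022_card_selmerGroup_le_pow_of_kuriharaNumber_ne_zero)
    (hnf : exists_isNewformOf) (hMaz : mazur_not_dvd_maninConstant_of_odd) :
    haveI := isElliptic_c916c1; haveI := isGloballyMinimal_c916c1; haveI := Fact.mk (by norm_num : Nat.Prime 5);
    ((((⟨0, 0, 0, -4, 1⟩ : WeierstrassCurve ℤ).map (Int.castRingHom ℚ))).sha ⊓ AddSubgroup.torsionBy (((⟨0, 0, 0, -4, 1⟩ : WeierstrassCurve ℤ).map (Int.castRingHom ℚ))).galH1 ((5 : ℕ) : ℤ) : AddSubgroup _) = ⊥ :=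
  sha_inf_torsionBy_five_eq_bot_of_kuriharaClaim hKim hnf hMaz kuriharaClaim_5_341

end C916c1

end Summit.BirchSwinnertonDyer.BirchSwinnertonDyer.Theorems.KolyvaginDepthDoor

end
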